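import Literature.Topology.FourManifolds.TrisectionsSectorsOneThree
import HarnessLib

/-!
# The top height with a separate below-band constant, and the first and third sector functions

Topic `Literature/Topology/FourManifolds`; step E4b′ of a Morse-theoretic construction of
Gay–Kirby's trisection for the fact seat
`provefact-Literature.Topology.FourManifolds.exists_isBalancedGKTrisection` (Gay–Kirby 2016,
Thm. 4 via §4, Lemma 14).  Everything in this file is **proved**; the definitions are explicit.

`HandleBoxes.topHeight` (`TrisectionsTopHeight.lean`) uses one constant `S_pl` both as the
plateau value of the profiles `T_P`, `h₂` (needed for the agreement of the two recipes of the raw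
top height) and as the value of `T` below the band.  The sign mechanism of
`TrisectionsSectorsOneThree.lean` (`D ≤ 0`) needs the below-band value to dominate the raw top
height, whose maximum `T_P(0)` exceeds the plateau.  This file separates the two rôles:

* `HandleBoxes.topHeightBot … S_pl S_bot S_min … = topHeight … S_pl S_min … + (1 - χ_lo(s)) (S_bot - S_pl)`
  — equal to `T_raw` on the plateau, to `S_bot` below and `-S_min` above the band, smooth;
* `ξ(T_bot) = D_bot ξ(f)` with `D_bot = χ_lo'(χ_hi T_raw - S_bot) + χ_hi'(χ_lo T_raw + S_min) ≤ 0`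
  when `-S_min ≤ T_raw ≤ S_bot` (`topCoeffBot_nonpos`);
* the sector functions `ψ₁ = 1 - C U₁(-s) V₁(T_bot/2 - s)`, `ψ₃ = 1 - C U₃(s - T_bot/2) V₃(s - T_bot)`
  (`psiOneBot`, `psiThreeBot`): no critical points on the band part of their sectors
  (`not_isMCriticalPt_psiOneBot`, `…ThreeBot`, by reduction to
  `HandleBoxes.not_isMCriticalPt_comp₂_of_ne` with the profile `Γ̃(p, q) = Γ(p + (1 - χ_lo(q - a))ΔS, q)`),
  and the Morse data of `f` below/above the band (`morseData_psiOneBot_below`, `…ThreeBot_above`).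

## References

* D. Gay, R. Kirby, *Trisecting 4-manifolds*, Geom. Topol. 20 (2016), §4, Lemma 14. [GayKirby2016]
* J. Milnor, *Morse theory* (1963), §2–§3. [Milnor1963]
-/

open scoped Manifold ContDiff Topology
open Set Function Filter Metric

noncomputable section

universe u

namespace Literature.Topology.FourManifolds

open Flow

/-- Local notation: `𝔼 n` is the model Euclidean space `EuclideanSpace ℝ (Fin n)`. -/
local notation "𝔼 " n:arg => EuclideanSpace ℝ (Fin n)

variable {X : Type u} [TopologicalSpace X] [T2Space X] [CompactSpace X] [ChartedSpace (𝔼 4) X]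
  [IsManifold (𝓡 4) ∞ X]
  {f : X → ℝ} {ξ : Π x : X, TangentSpace (𝓡 4) x} {a η : ℝ} {ι : Type} [Fintype ι]
  (H : HandleBoxes f ξ a η ι)
  {hξ : ContMDiff (𝓡 4) (𝓡 4).tangent ∞ fun x => (⟨x, ξ x⟩ : TangentBundle (𝓡 4) X)}
  {h : IsRegularLevel (𝓡 4) f a} {φ : RegularLevel h → ℝ} {h₂ TP χlo χhi : ℝ → ℝ} {Spl Sbot Smin Psw : ℝ}

namespace HandleBoxes

/-! ### The top height with a separate below-band constant -/

/-- **The top height** `T_bot = χ_lo χ_hi T_raw + (1 - χ_lo) S_bot - (1 - χ_hi) S_min`, i.e.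
`topHeight + (1 - χ_lo(s))(S_bot - S_pl)`. [cite: GayKirby2016, §4, Lemma 14] -/
def topHeightBot (hξ : ContMDiff (𝓡 4) (𝓡 4).tangent ∞ fun x => (⟨x, ξ x⟩ : TangentBundle (𝓡 4) X))
    (h : IsRegularLevel (𝓡 4) f a) (φ : RegularLevel h → ℝ) (h₂ TP χlo χhi : ℝ → ℝ)
    (Spl Sbot Smin Psw : ℝ) (z : X) : ℝ :=
  H.topHeight hξ h φ h₂ TP χlo χhi Spl Smin Psw z + (1 - χlo (f z - a)) * (Sbot - Spl)

/-- Unfolded: `T_bot = χ_lo χ_hi T_raw + (1 - χ_lo) S_bot - (1 - χ_hi) S_min`. [folklore] -/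
theorem topHeightBot_eq (z : X) :
    H.topHeightBot hξ h φ h₂ TP χlo χhi Spl Sbot Smin Psw z =
      χlo (f z - a) * χhi (f z - a) * H.topRaw hξ h φ h₂ TP Spl Psw z +
        (1 - χlo (f z - a)) * Sbot - (1 - χhi (f z - a)) * Smin := by
  simp only [topHeightBot, topHeight]; ring

/-- On the plateau (`χ_lo = χ_hi = 1`), `T_bot = T_raw`. [folklore] -/
theorem topHeightBot_of_eq_one {z : X} (hlo : χlo (f z - a) = 1) (hhi : χhi (f z - a) = 1) :
    H.topHeightBot hξ h φ h₂ TP χlo χhi Spl Sbot Smin Psw z = H.topRaw hξ h φ h₂ TP Spl Psw z := by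
  rw [topHeightBot_eq, hlo, hhi]; ring

/-- Below the band (`χ_lo = 0`, `χ_hi = 1`), `T_bot = S_bot`. [folklore] -/
theorem topHeightBot_of_lo {z : X} (hlo : χlo (f z - a) = 0) (hhi : χhi (f z - a) = 1) :
    H.topHeightBot hξ h φ h₂ TP χlo χhi Spl Sbot Smin Psw z = Sbot := by
  rw [topHeightBot_eq, hlo, hhi]; ring

/-- Above the band (`χ_lo = 1`, `χ_hi = 0`), `T_bot = -S_min`. [folklore] -/
theorem topHeightBot_of_hi {z : X} (hlo : χlo (f z - a) = 1) (hhi : χhi (f z - a) = 0) :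
    H.topHeightBot hξ h φ h₂ TP χlo χhi Spl Sbot Smin Psw z = -Smin := by
  rw [topHeightBot_eq, hlo, hhi]; ring

/-- **`T_bot` is smooth** when `topHeight` is and `χ_lo`, `f` are. [folklore] -/
theorem contMDiff_topHeightBot (hfM : IsMorse (𝓡 4) f) (hχlo : ContDiff ℝ ∞ χlo)
    (hT : ContMDiff (𝓡 4) 𝓘(ℝ, ℝ) ∞ (H.topHeight hξ h φ h₂ TP χlo χhi Spl Smin Psw)) :
    ContMDiff (𝓡 4) 𝓘(ℝ, ℝ) ∞ (H.topHeightBot hξ h φ h₂ TP χlo χhi Spl Sbot Smin Psw) := by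
  have hs : ContMDiff (𝓡 4) 𝓘(ℝ, ℝ) ∞ fun z => f z - a := hfM.contMDiff.sub contMDiff_const
  exact hT.add ((contMDiff_const.sub (hχlo.contMDiff.comp hs)).mul contMDiff_const)

/-- The shifted profile `Γ̃(p, q) = Γ(p + (1 - χ_lo(q - a))ΔS, q)` reading `Γ(T_bot, f)` as a
function of `(T, f)`. [folklore] -/
theorem comp₂_topHeightBot_eq (Γ : ℝ × ℝ → ℝ) :
    (fun w => Γ (H.topHeightBot hξ h φ h₂ TP χlo χhi Spl Sbot Smin Psw w, f w)) = fun w =>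
      (fun r : ℝ × ℝ => Γ (r.1 + (1 - χlo (r.2 - a)) * (Sbot - Spl), r.2))
        (H.topHeight hξ h φ h₂ TP χlo χhi Spl Smin Psw w, f w) := by
  funext w; rfl

/-- **The coefficient `D_bot` of `ξ(T_bot) = D_bot ξ(f)`**:
`D_bot = χ_lo'(s)(χ_hi(s) T_raw - S_bot) + χ_hi'(s)(χ_lo(s) T_raw + S_min)`. [folklore] -/
def topCoeffBot (hξ : ContMDiff (𝓡 4) (𝓡 4).tangent ∞ fun x => (⟨x, ξ x⟩ : TangentBundle (𝓡 4) X))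
    (h : IsRegularLevel (𝓡 4) f a) (φ : RegularLevel h → ℝ) (h₂ TP χlo χhi : ℝ → ℝ)
    (Spl Sbot Smin Psw : ℝ) (z : X) : ℝ :=
  deriv χlo (f z - a) * (χhi (f z - a) * H.topRaw hξ h φ h₂ TP Spl Psw z - Sbot) +
    deriv χhi (f z - a) * (χlo (f z - a) * H.topRaw hξ h φ h₂ TP Spl Psw z + Smin)

/-- `D_bot = D - χ_lo'(s)(S_bot - S_pl)`. [folklore] -/
theorem topCoeffBot_eq (z : X) :
    H.topCoeffBot hξ h φ h₂ TP χlo χhi Spl Sbot Smin Psw z =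
      H.topCoeff hξ h φ h₂ TP χlo χhi Spl Smin Psw z - deriv χlo (f z - a) * (Sbot - Spl) := by
  simp only [topCoeffBot, topCoeff]; ring

/-- **`D_bot ≤ 0`** for `χ_lo` nondecreasing, `χ_hi` nonincreasing, both in `[0, 1]`, `0 ≤ S_bot`,
`0 ≤ S_min`, `-S_min ≤ T_raw ≤ S_bot`. [folklore] -/
theorem topCoeffBot_nonpos {z : X} (hlo' : 0 ≤ deriv χlo (f z - a)) (hhi' : deriv χhi (f z - a) ≤ 0)
    (hlo : χlo (f z - a) ∈ Icc (0 : ℝ) 1) (hhi : χhi (f z - a) ∈ Icc (0 : ℝ) 1)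
    (hSbot : 0 ≤ Sbot) (hSmin : 0 ≤ Smin)
    (hR : H.topRaw hξ h φ h₂ TP Spl Psw z ∈ Icc (-Smin) Sbot) :
    H.topCoeffBot hξ h φ h₂ TP χlo χhi Spl Sbot Smin Psw z ≤ 0 := by
  unfold topCoeffBot
  set R := H.topRaw hξ h φ h₂ TP Spl Psw z
  have h1 : χhi (f z - a) * R - Sbot ≤ 0 := by
    rcases le_or_gt 0 R with hR0 | hR0
    · nlinarith [hhi.1, hhi.2, hR.2]
    · nlinarith [hhi.1, hhi.2]
  have h2 : 0 ≤ χlo (f z - a) * R + Smin := by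
    rcases le_or_gt 0 R with hR0 | hR0
    · nlinarith [hlo.1, hlo.2]
    · nlinarith [hlo.1, hlo.2, hR.1]
  nlinarith [mul_nonpos_of_nonneg_of_nonpos hlo' h1, mul_nonpos_of_nonpos_of_nonneg hhi' h2]

/-- **No critical point of `Γ(T_bot, f)` on the band where `∂₁Γ · D_bot + ∂₂Γ ≠ 0`**, off the
critical points of `f` (reduction to `not_isMCriticalPt_comp₂_of_ne` through the shifted
profile). [cite: GayKirby2016, §4, Lemma 14] -/
theorem not_isMCriticalPt_comp₂_bot_of_ne (hgl : IsGradientLike (𝓡 4) f ξ) (hfM : IsMorse (𝓡 4) f)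
    (hT : ContMDiff (𝓡 4) 𝓘(ℝ, ℝ) ∞ (H.topHeight hξ h φ h₂ TP χlo χhi Spl Smin Psw))
    (hχlo : ContDiff ℝ ∞ χlo) (hχhi : ContDiff ℝ ∞ χhi)
    {P₁ v₁ : ℝ} (hPsw0 : 0 < Psw) (hPsw : 2 * Psw ≤ η ^ 2) (hP₁ : 2 * P₁ < Psw)
    (hTP₂ : ∀ P, 2 * P₁ ≤ P → TP P = Spl) (hh₂v : ∀ t ≤ v₁, h₂ t = Spl)
    (hφv : ∀ j (y : RegularLevel h), y.1 ∈ (H.box j).chart.source → H.P j y.1 < 2 * Psw → φ y ≤ v₁)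
    {Γ : ℝ × ℝ → ℝ} {z : X} (hΓ : ContDiff ℝ 1 Γ)
    (hne : fderiv ℝ Γ (H.topHeightBot hξ h φ h₂ TP χlo χhi Spl Sbot Smin Psw z, f z) (1, 0) *
        H.topCoeffBot hξ h φ h₂ TP χlo χhi Spl Sbot Smin Psw z +
      fderiv ℝ Γ (H.topHeightBot hξ h φ h₂ TP χlo χhi Spl Sbot Smin Psw z, f z) (0, 1) ≠ 0)
    (hz : ¬ IsMCriticalPt (𝓡 4) f z) (hf₁ : a - η < f z) (hf₂ : f z < a + 2 * η) :
    ¬ IsMCriticalPt (𝓡 4) (fun w => Γ (H.topHeightBot hξ h φ h₂ TP χlo χhi Spl Sbot Smin Psw w, f w)) z := by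
  rw [H.comp₂_topHeightBot_eq Γ]
  set T := H.topHeight hξ h φ h₂ TP χlo χhi Spl Smin Psw with hTdef
  set ΔS := Sbot - Spl with hΔS
  -- the shifted profile and its partials
  set σ : ℝ × ℝ → ℝ × ℝ := fun r => (r.1 + (1 - χlo (r.2 - a)) * ΔS, r.2) with hσ
  have hχd : Differentiable ℝ χlo := hχlo.differentiable (by simp)
  have hσd : ∀ r, HasFDerivAt σ
      ((ContinuousLinearMap.fst ℝ ℝ ℝ + (-(deriv χlo (r.2 - a) * ΔS)) • ContinuousLinearMap.snd ℝ ℝ ℝ).prod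
        (ContinuousLinearMap.snd ℝ ℝ ℝ)) r := by
    intro r
    have h1 : HasFDerivAt (fun r : ℝ × ℝ => χlo (r.2 - a)) (deriv χlo (r.2 - a) • ContinuousLinearMap.snd ℝ ℝ ℝ) r := by
      have h0 : HasFDerivAt (fun r : ℝ × ℝ => r.2 - a) (ContinuousLinearMap.snd ℝ ℝ ℝ) r := by
        simpa using (ContinuousLinearMap.snd ℝ ℝ ℝ).hasFDerivAt.sub_const a
      exact (hχd (r.2 - a)).hasDerivAt.comp_hasFDerivAt r h0
    have h2 : HasFDerivAt (fun r : ℝ × ℝ => r.1 + (1 - χlo (r.2 - a)) * ΔS)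
        (ContinuousLinearMap.fst ℝ ℝ ℝ + (-(deriv χlo (r.2 - a) * ΔS)) • ContinuousLinearMap.snd ℝ ℝ ℝ) r := by
      have h3 := ((hasFDerivAt_const (1 : ℝ) r).sub h1).mul_const ΔS
      have h4 := (ContinuousLinearMap.fst ℝ ℝ ℝ).hasFDerivAt.add h3
      refine h4.congr_fderiv ?_
      ext <;> simp; ring
    exact h2.prodMk (ContinuousLinearMap.snd ℝ ℝ ℝ).hasFDerivAt
  have hΓd : ∀ q, DifferentiableAt ℝ Γ q := fun q => (hΓ.differentiable one_ne_zero) q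
  have hcomp : HasFDerivAt (Γ ∘ σ) ((fderiv ℝ Γ (σ (T z, f z))).comp
      ((ContinuousLinearMap.fst ℝ ℝ ℝ + (-(deriv χlo ((T z, f z).2 - a) * ΔS)) • ContinuousLinearMap.snd ℝ ℝ ℝ).prod
        (ContinuousLinearMap.snd ℝ ℝ ℝ))) (T z, f z) :=
    (hΓd _).hasFDerivAt.comp (T z, f z) (hσd (T z, f z))
  have hσz : σ (T z, f z) = (H.topHeightBot hξ h φ h₂ TP χlo χhi Spl Sbot Smin Psw z, f z) := by
    simp only [hσ, topHeightBot, hΔS, hTdef]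
  have h10 : fderiv ℝ (Γ ∘ σ) (T z, f z) (1, 0) =
      fderiv ℝ Γ (H.topHeightBot hξ h φ h₂ TP χlo χhi Spl Sbot Smin Psw z, f z) (1, 0) := by
    rw [hcomp.fderiv, hσz]
    simp
  have h01 : fderiv ℝ (Γ ∘ σ) (T z, f z) (0, 1) =
      fderiv ℝ Γ (H.topHeightBot hξ h φ h₂ TP χlo χhi Spl Sbot Smin Psw z, f z) (1, 0) * (-(deriv χlo (f z - a) * ΔS)) +
        fderiv ℝ Γ (H.topHeightBot hξ h φ h₂ TP χlo χhi Spl Sbot Smin Psw z, f z) (0, 1) := by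
    rw [hcomp.fderiv, hσz]
    simp only [ContinuousLinearMap.coe_comp, comp_apply, ContinuousLinearMap.prod_apply,
      add_apply, ContinuousLinearMap.coe_fst', ContinuousLinearMap.coe_snd',
      FunLike.coe_smul, Pi.smul_apply, smul_eq_mul, mul_one, zero_add]
    rw [fderiv_prod_apply']
    ring
  have hΓσd : DifferentiableAt ℝ (Γ ∘ σ) (T z, f z) := hcomp.differentiableAt
  refine H.not_isMCriticalPt_comp₂_of_ne hgl hfM hT hχlo hχhi hPsw0 hPsw hP₁ hTP₂ hh₂v hφv
    (Γ := Γ ∘ σ) hΓσd ?_ hz hf₁ hf₂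
  rw [h10, h01]
  intro h0
  apply hne
  rw [H.topCoeffBot_eq]
  linarith [h0]

/-! ### The sector functions over `T_bot` -/

/-- **The first sector's function** `ψ₁ = 1 - C U₁(-s) V₁(T_bot/2 - s)`. [cite: GayKirby2016, §4, Lemma 14] -/
def psiOneBot (hξ : ContMDiff (𝓡 4) (𝓡 4).tangent ∞ fun x => (⟨x, ξ x⟩ : TangentBundle (𝓡 4) X))
    (h : IsRegularLevel (𝓡 4) f a) (φ : RegularLevel h → ℝ) (h₂ TP χlo χhi : ℝ → ℝ)
    (Spl Sbot Smin Psw : ℝ) (U₁ V₁ : ℝ → ℝ) (C : ℝ) (z : X) : ℝ :=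
  1 - C * (U₁ (a - f z) * V₁ (H.topHeightBot hξ h φ h₂ TP χlo χhi Spl Sbot Smin Psw z / 2 - (f z - a)))

/-- **The third sector's function** `ψ₃ = 1 - C U₃(s - T_bot/2) V₃(s - T_bot)`. [cite: GayKirby2016, §4, Lemma 14] -/
def psiThreeBot (hξ : ContMDiff (𝓡 4) (𝓡 4).tangent ∞ fun x => (⟨x, ξ x⟩ : TangentBundle (𝓡 4) X))
    (h : IsRegularLevel (𝓡 4) f a) (φ : RegularLevel h → ℝ) (h₂ TP χlo χhi : ℝ → ℝ)
    (Spl Sbot Smin Psw : ℝ) (U₃ V₃ : ℝ → ℝ) (C : ℝ) (z : X) : ℝ :=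
  1 - C * (U₃ ((f z - a) - H.topHeightBot hξ h φ h₂ TP χlo χhi Spl Sbot Smin Psw z / 2) *
    V₃ ((f z - a) - H.topHeightBot hξ h φ h₂ TP χlo χhi Spl Sbot Smin Psw z))

variable {U₁ V₁ U₃ V₃ : ℝ → ℝ} {C : ℝ}

/-- `ψ₁` as `Γ(T_bot, f)`. [folklore] -/
theorem psiOneBot_eq : H.psiOneBot hξ h φ h₂ TP χlo χhi Spl Sbot Smin Psw U₁ V₁ C = fun z =>
    (fun r : ℝ × ℝ => 1 - C * (U₁ (a - r.2) * V₁ (r.1 / 2 - (r.2 - a))))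
      (H.topHeightBot hξ h φ h₂ TP χlo χhi Spl Sbot Smin Psw z, f z) := rfl

/-- `ψ₃` as `Γ(T_bot, f)`. [folklore] -/
theorem psiThreeBot_eq : H.psiThreeBot hξ h φ h₂ TP χlo χhi Spl Sbot Smin Psw U₃ V₃ C = fun z =>
    (fun r : ℝ × ℝ => 1 - C * (U₃ ((r.2 - a) - r.1 / 2) * V₃ ((r.2 - a) - r.1)))
      (H.topHeightBot hξ h φ h₂ TP χlo χhi Spl Sbot Smin Psw z, f z) := rfl

/-- `1 - C Γ₁` is `C¹` for smooth profiles. [folklore] -/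
theorem contDiff_gammaOne' (hU : ContDiff ℝ ∞ U₁) (hV : ContDiff ℝ ∞ V₁) (C a : ℝ) :
    ContDiff ℝ 1 fun r : ℝ × ℝ => 1 - C * (U₁ (a - r.2) * V₁ (r.1 / 2 - (r.2 - a))) := by
  have h1 : ContDiff ℝ 1 fun r : ℝ × ℝ => a - r.2 := by fun_prop
  have h2 : ContDiff ℝ 1 fun r : ℝ × ℝ => r.1 / 2 - (r.2 - a) := by fun_prop
  exact contDiff_const.sub (contDiff_const.mul (((hU.of_le (by norm_cast)).comp h1).mul ((hV.of_le (by norm_cast)).comp h2)))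

/-- `1 - C Γ₃` is `C¹` for smooth profiles. [folklore] -/
theorem contDiff_gammaThree' (hU : ContDiff ℝ ∞ U₃) (hV : ContDiff ℝ ∞ V₃) (C a : ℝ) :
    ContDiff ℝ 1 fun r : ℝ × ℝ => 1 - C * (U₃ ((r.2 - a) - r.1 / 2) * V₃ ((r.2 - a) - r.1)) := by
  have h1 : ContDiff ℝ 1 fun r : ℝ × ℝ => (r.2 - a) - r.1 / 2 := by fun_prop
  have h2 : ContDiff ℝ 1 fun r : ℝ × ℝ => (r.2 - a) - r.1 := by fun_prop
  exact contDiff_const.sub (contDiff_const.mul (((hU.of_le (by norm_cast)).comp h1).mul ((hV.of_le (by norm_cast)).comp h2)))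

/-- **`ψ₁` has no critical point on the band part of the first sector** (incl. its faces off
`F`): band point with `f z ≤ a`, `D_bot(z) ≤ 0`, `U₁ ≥ 0`, `V₁' ≥ 0`, `U₁'V₁ + U₁V₁' > 0`, `C ≠ 0`.
[cite: GayKirby2016, §4, Lemma 14] -/
theorem not_isMCriticalPt_psiOneBot (hgl : IsGradientLike (𝓡 4) f ξ) (hfM : IsMorse (𝓡 4) f)
    (hT : ContMDiff (𝓡 4) 𝓘(ℝ, ℝ) ∞ (H.topHeight hξ h φ h₂ TP χlo χhi Spl Smin Psw))
    (hχlo : ContDiff ℝ ∞ χlo) (hχhi : ContDiff ℝ ∞ χhi)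
    {P₁ v₁ : ℝ} (hPsw0 : 0 < Psw) (hPsw : 2 * Psw ≤ η ^ 2) (hP₁ : 2 * P₁ < Psw)
    (hTP₂ : ∀ P, 2 * P₁ ≤ P → TP P = Spl) (hh₂v : ∀ t ≤ v₁, h₂ t = Spl)
    (hφv : ∀ j (y : RegularLevel h), y.1 ∈ (H.box j).chart.source → H.P j y.1 < 2 * Psw → φ y ≤ v₁)
    (hU : ContDiff ℝ ∞ U₁) (hV : ContDiff ℝ ∞ V₁) (hC : C ≠ 0)
    {z : X} (hf₁ : a - η < f z) (hf₂ : f z ≤ a)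
    (hD : H.topCoeffBot hξ h φ h₂ TP χlo χhi Spl Sbot Smin Psw z ≤ 0)
    (hUz : 0 ≤ U₁ (a - f z))
    (hV'z : 0 ≤ deriv V₁ (H.topHeightBot hξ h φ h₂ TP χlo χhi Spl Sbot Smin Psw z / 2 - (f z - a)))
    (hpos : 0 < deriv U₁ (a - f z) * V₁ (H.topHeightBot hξ h φ h₂ TP χlo χhi Spl Sbot Smin Psw z / 2 - (f z - a)) +
      U₁ (a - f z) * deriv V₁ (H.topHeightBot hξ h φ h₂ TP χlo χhi Spl Sbot Smin Psw z / 2 - (f z - a))) :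
    ¬ IsMCriticalPt (𝓡 4) (H.psiOneBot hξ h φ h₂ TP χlo χhi Spl Sbot Smin Psw U₁ V₁ C) z := by
  have hη := H.eta_pos
  rw [psiOneBot_eq]
  set Tb := H.topHeightBot hξ h φ h₂ TP χlo χhi Spl Sbot Smin Psw with hTb
  obtain ⟨hΓd, h10, h01⟩ := gammaOne_partials hU hV a (Tb z, f z)
  have hfd : fderiv ℝ (fun r : ℝ × ℝ => 1 - C * (U₁ (a - r.2) * V₁ (r.1 / 2 - (r.2 - a)))) (Tb z, f z) =
      (-C) • fderiv ℝ (fun r : ℝ × ℝ => U₁ (a - r.2) * V₁ (r.1 / 2 - (r.2 - a))) (Tb z, f z) := by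
    rw [fderiv_const_sub, fderiv_const_mul hΓd, ← neg_smul]
  refine H.not_isMCriticalPt_comp₂_bot_of_ne hgl hfM hT hχlo hχhi hPsw0 hPsw hP₁ hTP₂ hh₂v hφv
    (contDiff_gammaOne' hU hV C a) ?_ (H.not_isMCriticalPt_of_band (by linarith) (by linarith) (by linarith)) hf₁ (by linarith)
  rw [hfd]
  simp only [FunLike.coe_smul, Pi.smul_apply, smul_eq_mul, h10, h01]
  have hterm : U₁ (a - f z) * deriv V₁ (Tb z / 2 - (f z - a)) / 2 * H.topCoeffBot hξ h φ h₂ TP χlo χhi Spl Sbot Smin Psw z ≤ 0 :=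
    mul_nonpos_of_nonneg_of_nonpos (by positivity) hD
  intro h0
  have : -C * (U₁ (a - f z) * deriv V₁ (Tb z / 2 - (f z - a)) / 2 * H.topCoeffBot hξ h φ h₂ TP χlo χhi Spl Sbot Smin Psw z +
      -(deriv U₁ (a - f z) * V₁ (Tb z / 2 - (f z - a)) + U₁ (a - f z) * deriv V₁ (Tb z / 2 - (f z - a)))) = 0 := by
    linarith [h0]
  rcases mul_eq_zero.1 this with h' | h'
  · exact hC (neg_eq_zero.1 h')
  · linarith

/-- **`ψ₃` has no critical point on the band part of the third sector** (incl. its faces off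
`F`): band point off the level `a + η`, `D_bot(z) ≤ 0`, `U₃, U₃', V₃, V₃' ≥ 0`, `U₃'V₃ + U₃V₃' > 0`,
`C ≠ 0`. [cite: GayKirby2016, §4, Lemma 14] -/
theorem not_isMCriticalPt_psiThreeBot (hgl : IsGradientLike (𝓡 4) f ξ) (hfM : IsMorse (𝓡 4) f)
    (hT : ContMDiff (𝓡 4) 𝓘(ℝ, ℝ) ∞ (H.topHeight hξ h φ h₂ TP χlo χhi Spl Smin Psw))
    (hχlo : ContDiff ℝ ∞ χlo) (hχhi : ContDiff ℝ ∞ χhi)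
    {P₁ v₁ : ℝ} (hPsw0 : 0 < Psw) (hPsw : 2 * Psw ≤ η ^ 2) (hP₁ : 2 * P₁ < Psw)
    (hTP₂ : ∀ P, 2 * P₁ ≤ P → TP P = Spl) (hh₂v : ∀ t ≤ v₁, h₂ t = Spl)
    (hφv : ∀ j (y : RegularLevel h), y.1 ∈ (H.box j).chart.source → H.P j y.1 < 2 * Psw → φ y ≤ v₁)
    (hU : ContDiff ℝ ∞ U₃) (hV : ContDiff ℝ ∞ V₃) (hC : C ≠ 0)
    {z : X} (hf₁ : a - η < f z) (hf₂ : f z < a + 2 * η) (hne : f z ≠ a + η)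
    (hD : H.topCoeffBot hξ h φ h₂ TP χlo χhi Spl Sbot Smin Psw z ≤ 0)
    (hUz : 0 ≤ U₃ ((f z - a) - H.topHeightBot hξ h φ h₂ TP χlo χhi Spl Sbot Smin Psw z / 2))
    (hU'z : 0 ≤ deriv U₃ ((f z - a) - H.topHeightBot hξ h φ h₂ TP χlo χhi Spl Sbot Smin Psw z / 2))
    (hVz : 0 ≤ V₃ ((f z - a) - H.topHeightBot hξ h φ h₂ TP χlo χhi Spl Sbot Smin Psw z))
    (hV'z : 0 ≤ deriv V₃ ((f z - a) - H.topHeightBot hξ h φ h₂ TP χlo χhi Spl Sbot Smin Psw z))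
    (hpos : 0 < deriv U₃ ((f z - a) - H.topHeightBot hξ h φ h₂ TP χlo χhi Spl Sbot Smin Psw z / 2) *
        V₃ ((f z - a) - H.topHeightBot hξ h φ h₂ TP χlo χhi Spl Sbot Smin Psw z) +
      U₃ ((f z - a) - H.topHeightBot hξ h φ h₂ TP χlo χhi Spl Sbot Smin Psw z / 2) *
        deriv V₃ ((f z - a) - H.topHeightBot hξ h φ h₂ TP χlo χhi Spl Sbot Smin Psw z)) :
    ¬ IsMCriticalPt (𝓡 4) (H.psiThreeBot hξ h φ h₂ TP χlo χhi Spl Sbot Smin Psw U₃ V₃ C) z := by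
  rw [psiThreeBot_eq]
  set Tb := H.topHeightBot hξ h φ h₂ TP χlo χhi Spl Sbot Smin Psw with hTb
  obtain ⟨hΓd, h10, h01⟩ := gammaThree_partials hU hV a (Tb z, f z)
  have hfd : fderiv ℝ (fun r : ℝ × ℝ => 1 - C * (U₃ ((r.2 - a) - r.1 / 2) * V₃ ((r.2 - a) - r.1))) (Tb z, f z) =
      (-C) • fderiv ℝ (fun r : ℝ × ℝ => U₃ ((r.2 - a) - r.1 / 2) * V₃ ((r.2 - a) - r.1)) (Tb z, f z) := by
    rw [fderiv_const_sub, fderiv_const_mul hΓd, ← neg_smul]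
  refine H.not_isMCriticalPt_comp₂_bot_of_ne hgl hfM hT hχlo hχhi hPsw0 hPsw hP₁ hTP₂ hh₂v hφv
    (contDiff_gammaThree' hU hV C a) ?_ (H.not_isMCriticalPt_of_band hf₁.le hf₂ hne) hf₁ hf₂
  rw [hfd]
  simp only [FunLike.coe_smul, Pi.smul_apply, smul_eq_mul, h10, h01]
  have hterm : 0 ≤ -(deriv U₃ ((f z - a) - Tb z / 2) * V₃ ((f z - a) - Tb z) / 2 +
      U₃ ((f z - a) - Tb z / 2) * deriv V₃ ((f z - a) - Tb z)) * H.topCoeffBot hξ h φ h₂ TP χlo χhi Spl Sbot Smin Psw z := by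
    have h1 : 0 ≤ deriv U₃ ((f z - a) - Tb z / 2) * V₃ ((f z - a) - Tb z) / 2 +
        U₃ ((f z - a) - Tb z / 2) * deriv V₃ ((f z - a) - Tb z) := by positivity
    nlinarith
  intro h0
  have : -C * (-(deriv U₃ ((f z - a) - Tb z / 2) * V₃ ((f z - a) - Tb z) / 2 +
        U₃ ((f z - a) - Tb z / 2) * deriv V₃ ((f z - a) - Tb z)) * H.topCoeffBot hξ h φ h₂ TP χlo χhi Spl Sbot Smin Psw z +
      (deriv U₃ ((f z - a) - Tb z / 2) * V₃ ((f z - a) - Tb z) + U₃ ((f z - a) - Tb z / 2) * deriv V₃ ((f z - a) - Tb z))) = 0 := by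
    linarith [h0]
  rcases mul_eq_zero.1 this with h' | h'
  · exact hC (neg_eq_zero.1 h')
  · linarith

/-- **Below the band, `ψ₁` is a function of `f` with the Morse data of `f`** (`T_bot = S_bot`,
`U₁ = 1` near the point): critical iff `f` is; then nondegenerate with the index of `f`.
[cite: GayKirby2016, §4, Lemma 14] [cite: Milnor1963, §2–§3] -/
theorem morseData_psiOneBot_below (hfM : IsMorse (𝓡 4) f) (hV : ContDiff ℝ ∞ V₁) (hC : 0 < C)
    {z : X} (hcut : ∀ᶠ s in 𝓝 (f z - a), χlo s = 0 ∧ χhi s = 1) (hU1 : ∀ᶠ u in 𝓝 (a - f z), U₁ u = 1)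
    (hV' : 0 < deriv V₁ (Sbot / 2 - (f z - a))) :
    (IsMCriticalPt (𝓡 4) (H.psiOneBot hξ h φ h₂ TP χlo χhi Spl Sbot Smin Psw U₁ V₁ C) z ↔ IsMCriticalPt (𝓡 4) f z) ∧
      (IsMCriticalPt (𝓡 4) f z →
        (mhessian (𝓡 4) (H.psiOneBot hξ h φ h₂ TP χlo χhi Spl Sbot Smin Psw U₁ V₁ C) z).Nondegenerate ∧
          morseIndex (𝓡 4) (H.psiOneBot hξ h φ h₂ TP χlo χhi Spl Sbot Smin Psw U₁ V₁ C) z = morseIndex (𝓡 4) f z) := by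
  have hcontf : Continuous f := hfM.contMDiff.continuous
  set φ₀ : ℝ → ℝ := fun q => 1 - C * V₁ (Sbot / 2 - (q - a)) with hφ₀
  have hs : Tendsto (fun w => f w - a) (𝓝 z) (𝓝 (f z - a)) := (hcontf.continuousAt.sub continuousAt_const).tendsto
  have hs' : Tendsto (fun w => a - f w) (𝓝 z) (𝓝 (a - f z)) := (continuousAt_const.sub hcontf.continuousAt).tendsto
  have hev : H.psiOneBot hξ h φ h₂ TP χlo χhi Spl Sbot Smin Psw U₁ V₁ C =ᶠ[𝓝 z] fun w => φ₀ (f w) + 0 := by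
    filter_upwards [hs.eventually hcut, hs'.eventually hU1] with w hw hwU
    simp only [psiOneBot, H.topHeightBot_of_lo hw.1 hw.2, hwU, one_mul, hφ₀, add_zero]
  have hcrit := isMCriticalPt_congr_of_eventuallyEq_add_const (I := 𝓡 4) hev
  have hhess := mhessian_congr_of_eventuallyEq_add_const (I := 𝓡 4) hev
  have hφ₀c : ContDiff ℝ ∞ φ₀ :=
    contDiff_const.sub (contDiff_const.mul (hV.comp (contDiff_const.sub (contDiff_id.sub contDiff_const))))
  have hφ₀' : deriv φ₀ (f z) = C * deriv V₁ (Sbot / 2 - (f z - a)) := by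
    have h1 : HasDerivAt (fun q : ℝ => Sbot / 2 - (q - a)) (-1) (f z) := by
      simpa using ((hasDerivAt_id (f z)).sub_const a).const_sub (Sbot / 2)
    have h2 := ((hV.differentiable (by simp)) _).hasDerivAt.comp (f z) h1
    have h3 : HasDerivAt φ₀ (0 - C * (deriv V₁ (Sbot / 2 - (f z - a)) * (-1))) (f z) :=
      (hasDerivAt_const _ _).sub (h2.const_mul C)
    rw [h3.deriv]; ring
  have hd : deriv φ₀ (f z) ≠ 0 := by rw [hφ₀']; positivity
  have hfd : MDifferentiableAt (𝓡 4) 𝓘(ℝ, ℝ) f z := hfM.contMDiff.mdifferentiableAt (by simp)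
  have hcrit₀ : IsMCriticalPt (𝓡 4) (fun y => φ₀ (f y)) z ↔ IsMCriticalPt (𝓡 4) f z :=
    isMCriticalPt_real_comp_iff' ((hφ₀c.differentiable (by simp)) _).hasDerivAt hd hfd
  refine ⟨hcrit.trans hcrit₀, fun hfz => ?_⟩
  obtain ⟨-, hnd, hidx, -⟩ := morseData_real_comp (hφ₀c.contDiffAt.of_le (by norm_cast))
    ((hfM.contMDiff z).of_le (by norm_cast)) hfz hd
  refine ⟨?_, ?_⟩
  · rw [hhess, hnd]; exact hfM.nondegenerate hfz
  · unfold morseIndex; rw [hhess]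
    exact hidx (by rw [hφ₀']; positivity)

/-- **Above the band, `ψ₃` is a function of `f` with the Morse data of `-f`** (`T_bot = -S_min`,
`U₃ = 1` near the point): critical iff `f` is; then nondegenerate with `index ψ₃ + index f = 4`.
[cite: GayKirby2016, §4, Lemma 14] [cite: Milnor1963, §2–§3] -/
theorem morseData_psiThreeBot_above (hfM : IsMorse (𝓡 4) f) (hV : ContDiff ℝ ∞ V₃) (hC : 0 < C)
    {z : X} (hcut : ∀ᶠ s in 𝓝 (f z - a), χlo s = 1 ∧ χhi s = 0)
    (hU1 : ∀ᶠ u in 𝓝 ((f z - a) + Smin / 2), U₃ u = 1) (hV' : 0 < deriv V₃ ((f z - a) + Smin)) :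
    (IsMCriticalPt (𝓡 4) (H.psiThreeBot hξ h φ h₂ TP χlo χhi Spl Sbot Smin Psw U₃ V₃ C) z ↔ IsMCriticalPt (𝓡 4) f z) ∧
      (IsMCriticalPt (𝓡 4) f z →
        (mhessian (𝓡 4) (H.psiThreeBot hξ h φ h₂ TP χlo χhi Spl Sbot Smin Psw U₃ V₃ C) z).Nondegenerate ∧
          morseIndex (𝓡 4) (H.psiThreeBot hξ h φ h₂ TP χlo χhi Spl Sbot Smin Psw U₃ V₃ C) z + morseIndex (𝓡 4) f z = 4) := by
  have hcontf : Continuous f := hfM.contMDiff.continuous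
  set φ₀ : ℝ → ℝ := fun q => 1 - C * V₃ ((q - a) + Smin) with hφ₀
  have hs : Tendsto (fun w => f w - a) (𝓝 z) (𝓝 (f z - a)) := (hcontf.continuousAt.sub continuousAt_const).tendsto
  have hs' : Tendsto (fun w => (f w - a) + Smin / 2) (𝓝 z) (𝓝 ((f z - a) + Smin / 2)) := hs.add_const _
  have hev : H.psiThreeBot hξ h φ h₂ TP χlo χhi Spl Sbot Smin Psw U₃ V₃ C =ᶠ[𝓝 z] fun w => φ₀ (f w) + 0 := by
    filter_upwards [hs.eventually hcut, hs'.eventually hU1] with w hw hwU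
    have hT : H.topHeightBot hξ h φ h₂ TP χlo χhi Spl Sbot Smin Psw w = -Smin := H.topHeightBot_of_hi hw.1 hw.2
    simp only [psiThreeBot, hT, hφ₀, add_zero]
    rw [show (f w - a) - -Smin / 2 = (f w - a) + Smin / 2 by ring, hwU, one_mul,
      show (f w - a) - -Smin = (f w - a) + Smin by ring]
  have hcrit := isMCriticalPt_congr_of_eventuallyEq_add_const (I := 𝓡 4) hev
  have hhess := mhessian_congr_of_eventuallyEq_add_const (I := 𝓡 4) hev
  have hφ₀c : ContDiff ℝ ∞ φ₀ :=
    contDiff_const.sub (contDiff_const.mul (hV.comp ((contDiff_id.sub contDiff_const).add contDiff_const)))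
  have hφ₀' : deriv φ₀ (f z) = -(C * deriv V₃ ((f z - a) + Smin)) := by
    have h1 : HasDerivAt (fun q : ℝ => (q - a) + Smin) 1 (f z) := by
      simpa using ((hasDerivAt_id (f z)).sub_const a).add_const Smin
    have h2 := ((hV.differentiable (by simp)) _).hasDerivAt.comp (f z) h1
    have h3 : HasDerivAt φ₀ (0 - C * (deriv V₃ ((f z - a) + Smin) * 1)) (f z) :=
      (hasDerivAt_const _ _).sub (h2.const_mul C)
    rw [h3.deriv]; ring
  have hd : deriv φ₀ (f z) ≠ 0 := by rw [hφ₀']; exact neg_ne_zero.2 (by positivity)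
  have hfd : MDifferentiableAt (𝓡 4) 𝓘(ℝ, ℝ) f z := hfM.contMDiff.mdifferentiableAt (by simp)
  have hcrit₀ : IsMCriticalPt (𝓡 4) (fun y => φ₀ (f y)) z ↔ IsMCriticalPt (𝓡 4) f z :=
    isMCriticalPt_real_comp_iff' ((hφ₀c.differentiable (by simp)) _).hasDerivAt hd hfd
  refine ⟨hcrit.trans hcrit₀, fun hfz => ?_⟩
  obtain ⟨-, hnd, -, hidx⟩ := morseData_real_comp (hφ₀c.contDiffAt.of_le (by norm_cast))
    ((hfM.contMDiff z).of_le (by norm_cast)) hfz hd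
  refine ⟨?_, ?_⟩
  · rw [hhess, hnd]; exact hfM.nondegenerate hfz
  · unfold morseIndex; rw [hhess]
    exact hidx (by rw [hφ₀']; exact neg_neg_of_pos (by positivity)) (hfM.nondegenerate hfz)

end HandleBoxes

end Literature.Topology.FourManifolds

end
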